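import Summits.CriticalPhenomena.PercolationContinuityZ3.Theorems.PercNearOneGluingNoHeavyLowerTailKNQuestion7AllRelays
import Summits.CriticalPhenomena.PercolationContinuityZ3.Theorems.PercNearOneGluingNoHeavyLowerTailBlockQ9ReliableBlock
import Summits.CriticalPhenomena.PercolationContinuityZ3.Theorems.PercNearOneGluingAdditiveGluingBlockGrowth
import HarnessLib

/-!
# `NoHeavyLowerTail` (stmt-CriticalPhenomena-4575) — SET-GAIN for blocks of every size: gluing a vertex set helps its
# a-priori weakest member at least as much as it helps any other vertex (Kozma–Nitzan's Lemma 4 for a block)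

Support file (hull-port prover `prim-hp-1` gen 15; `--supports stmt-CriticalPhenomena-4575`).  No definitions, no named facts,
no sorries.  Memo: `run/shared/lean/prim/prim-hp-1/CONJECTURES-gen15.md` (conjecture SET-GAIN / KN-L4-SET of gen 14, §53(g) of
`HULLPORT-COUPLING.md`; literature analysis `FROM-prim-lit-3-gen29-SETGAIN.md`).

`S` a finite vertex set, `g ∈ S` its a-priori least `b`-reliable member (`μ(g ↔ b) ≤ μ(s ↔ b)`, `s ∈ S`), `x` any vertex.
Kozma–Nitzan derive their Lemma 4 (`|S| = 2`, arXiv:2401.12397 pp. 9–10; tree: `UpsetExchange.pairGlue_gain_le`) from the pre-FKG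
inequality (41) for two relays (Theorem 1); the same three lines run for any `S` once (41) is available for the relay set `S` —
and the tree answers Question 7 for every relay set (`Q7Psi.kn_question7`, via `CSH.cshAll`, p205010).  Hence, for every `|S|`:

* `BlockQ9.setGain_event_le` — `μ(x ↮ b, x ↔ S, S ↔ b) + μ(g ↔ b) ≤ μ(S ↔ b)`
  ("`S` pivotal for `x ↔ b`" has probability at most "`S ↔ b` but `g ↮ b`").
* `BlockQ9.setGain_glue_le` — glued form: `μ_{glue_S w}(x ↔ b) − μ_w(x ↔ b) ≤ μ_w(S ↔ b) − μ_w(g ↔ b)`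
  (`blockGrowth_glue_real_openConn` un-glues the two-point function).
* `BlockQ9.setGain_le_weakest` — `μ_{glue_S w}(x ↔ b) − μ_w(x ↔ b) ≤ μ_{glue_S w}(g ↔ b) − μ_w(g ↔ b)`:
  the gluing gain of any vertex is at most the gluing gain of the block's weakest member.
The conditional derivation "(41)-instance ⇒ SET-GAIN-instance" is prim-lit-3's `Literature.Probability.Percolation.setPivotal_le_of_preFKG`
(p206846); this file discharges its hypothesis with Question 7, which lives Summits-side.  For `|S| ≥ 3` the statement is not in print.
[cite: KozmaNitzan2024, Lemma 4 and eq. (8)–(9) (pp. 9–10), Question 7 (p. 36)]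
-/

namespace Summit.CriticalPhenomena.PercolationContinuityZ3.Theorems

open MeasureTheory Set
open Literature.Probability.LatticeModels
open Literature.Probability.Percolation

noncomputable section
open Classical

namespace BlockQ9

variable {n : ℕ}

/-- **SET-GAIN, event form, every block size.**  `g ∈ S` with `μ(g ↔ b) ≤ μ(s ↔ b)` for all `s ∈ S`; then for every
vertex `x`:  `μ({x ↮ b} ∩ {x ↔ S} ∩ {S ↔ b}) + μ(g ↔ b) ≤ μ(S ↔ b)`.  Proof (Kozma–Nitzan p. 9 verbatim for a block):
`μ(x↮b, x↔S, S↔b) = μ(x↔S, S↔b) − μ(x↔b, x↔S) ≤ μ(x↔S, S↔b) − μ(g↔b, x↔S) = μ(x↔S, S↔b, g↮b) ≤ μ(S↔b) − μ(g↔b)`, the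
inequality being Question 7 at the observer `x` with relay set `S` (`Q7Psi.kn_question7`).
[cite: KozmaNitzan2024, Lemma 4 (pp. 9–10), Question 7 (p. 36)] -/
theorem setGain_event_le (w : Sym2 (Fin n) → unitInterval) (S : Finset (Fin n)) (x b g : Fin n) (hg : g ∈ S)
    (hmin : ∀ s ∈ S, (prodBernoulli w).real (openConn g b) ≤ (prodBernoulli w).real (openConn s b)) :
    (prodBernoulli w).real ((openConn x b)ᶜ ∩ (⋃ s ∈ S, openConn x s) ∩ (⋃ s ∈ S, openConn s b)) +
        (prodBernoulli w).real (openConn g b) ≤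
      (prodBernoulli w).real (⋃ s ∈ S, openConn s b) := by
  set μ := prodBernoulli w with hμ
  set XS : Set (BondConfig (Fin n)) := ⋃ s ∈ S, openConn x s with hXS
  set SB : Set (BondConfig (Fin n)) := ⋃ s ∈ S, openConn s b with hSB
  have hmeas : ∀ E : Set (BondConfig (Fin n)), MeasurableSet E := fun _ => MeasurableSet.of_discrete
  -- Question 7 at the observer `x`, relay set `S`, designated relay `g`
  have key : μ.real (openConn g b ∩ XS) ≤ μ.real (openConn x b ∩ XS) := Q7Psi.kn_question7 w S x b g hg hmin
  -- `{x ↔ b} ∩ {x ↔ S} ⊆ {S ↔ b}` and `{g ↔ b} ⊆ {S ↔ b}`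
  have h1 : (openConn x b : Set (BondConfig (Fin n))) ∩ XS ⊆ SB := by
    rintro ω ⟨hxb, hxS⟩
    obtain ⟨s, hs, hxs⟩ := mem_iUnion₂.1 hxS
    have hxb' : (openGraph ω).Reachable x b := hxb
    have hxs' : (openGraph ω).Reachable x s := hxs
    exact mem_iUnion₂.2 ⟨s, hs, hxs'.symm.trans hxb'⟩
  have h2 : (openConn g b : Set (BondConfig (Fin n))) ⊆ SB := fun ω hω => mem_iUnion₂.2 ⟨g, hg, hω⟩
  -- mass bookkeeping
  have d1 : μ.real (XS ∩ SB ∩ openConn x b) + μ.real ((XS ∩ SB) \ openConn x b) = μ.real (XS ∩ SB) :=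
    measureReal_inter_add_sdiff (hmeas _) (measure_ne_top _ _)
  have d2 : μ.real (SB ∩ openConn g b) + μ.real (SB \ openConn g b) = μ.real SB :=
    measureReal_inter_add_sdiff (hmeas _) (measure_ne_top _ _)
  have d3 : μ.real (XS ∩ SB ∩ openConn g b) + μ.real ((XS ∩ SB) \ openConn g b) = μ.real (XS ∩ SB) :=
    measureReal_inter_add_sdiff (hmeas _) (measure_ne_top _ _)
  have e1 : XS ∩ SB ∩ openConn x b = openConn x b ∩ XS := by
    ext ω
    constructor
    · rintro ⟨⟨hXS', -⟩, hxb⟩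
      exact ⟨hxb, hXS'⟩
    · rintro ⟨hxb, hXS'⟩
      exact ⟨⟨hXS', h1 ⟨hxb, hXS'⟩⟩, hxb⟩
  have e2 : (XS ∩ SB) \ openConn x b = (openConn x b)ᶜ ∩ XS ∩ SB := by
    ext ω
    simp only [mem_sdiff, mem_inter_iff, mem_compl_iff]
    tauto
  have e3 : SB ∩ openConn g b = openConn g b := inter_eq_right.2 h2
  have e4 : XS ∩ SB ∩ openConn g b = openConn g b ∩ XS := by
    ext ω
    constructor
    · rintro ⟨⟨hXS', -⟩, hgb⟩
      exact ⟨hgb, hXS'⟩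
    · rintro ⟨hgb, hXS'⟩
      exact ⟨⟨hXS', h2 hgb⟩, hgb⟩
  have m1 : μ.real ((XS ∩ SB) \ openConn g b) ≤ μ.real (SB \ openConn g b) :=
    measureReal_mono (sdiff_subset_sdiff_left inter_subset_right) (measure_ne_top _ _)
  rw [e1, e2] at d1
  rw [e3] at d2
  rw [e4] at d3
  linarith

/-- **SET-GAIN, glued form, every block size.**  `g ∈ S` a-priori weakest towards `b`; then for every vertex `x`:
`μ_{glue_S w}(x ↔ b) − μ_w(x ↔ b) ≤ μ_w(S ↔ b) − μ_w(g ↔ b)`  (the block version of Kozma–Nitzan's display (9)).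
[cite: KozmaNitzan2024, Lemma 4 and display (9) (pp. 9–10), Question 7 (p. 36)] -/
theorem setGain_glue_le (w : Sym2 (Fin n) → unitInterval) (S : Finset (Fin n)) (x b g : Fin n) (hg : g ∈ S)
    (hmin : ∀ s ∈ S, (prodBernoulli w).real (openConn g b) ≤ (prodBernoulli w).real (openConn s b)) :
    (prodBernoulli (fun e : Sym2 (Fin n) => if (∀ y ∈ e, y ∈ S) ∧ ¬ e.IsDiag then 1 else w e)).real (openConn x b) -
        (prodBernoulli w).real (openConn x b) ≤
      (prodBernoulli w).real (⋃ s ∈ S, openConn s b) - (prodBernoulli w).real (openConn g b) := by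
  rw [blockGrowth_glue_real_openConn w S x b]
  have h := setGain_event_le w S x b g hg hmin
  linarith

/-- **Gluing helps the weakest member most.**  `g ∈ S` a-priori weakest towards `b`; then for every vertex `x`:
`μ_{glue_S w}(x ↔ b) − μ_w(x ↔ b) ≤ μ_{glue_S w}(g ↔ b) − μ_w(g ↔ b)` — the gluing gain of any vertex is at most the gluing
gain of the block's weakest member (for `g` in the glued block, `{g ↔ b} = {S ↔ b}` almost surely, and the block's reach of `b`
is glue-invariant, `blockGrowth_glue_real_iUnion`). [cite: KozmaNitzan2024, Lemma 4 (pp. 9–10), Question 7 (p. 36)] -/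
theorem setGain_le_weakest (w : Sym2 (Fin n) → unitInterval) (S : Finset (Fin n)) (x b g : Fin n) (hg : g ∈ S)
    (hmin : ∀ s ∈ S, (prodBernoulli w).real (openConn g b) ≤ (prodBernoulli w).real (openConn s b)) :
    (prodBernoulli (fun e : Sym2 (Fin n) => if (∀ y ∈ e, y ∈ S) ∧ ¬ e.IsDiag then 1 else w e)).real (openConn x b) -
        (prodBernoulli w).real (openConn x b) ≤
      (prodBernoulli (fun e : Sym2 (Fin n) => if (∀ y ∈ e, y ∈ S) ∧ ¬ e.IsDiag then 1 else w e)).real (openConn g b) -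
        (prodBernoulli w).real (openConn g b) := by
  set gl : Sym2 (Fin n) → unitInterval := fun e => if (∀ y ∈ e, y ∈ S) ∧ ¬ e.IsDiag then 1 else w e with hgl
  -- in the glued graph the weakest member's reach of `b` is the block's reach of `b`
  set K : Set (BondConfig (Fin n)) := {ω | ∀ o ∈ S, ∀ o' ∈ S, o ≠ o' → s(o, o') ∈ ω} with hK
  have hKc : prodBernoulli gl Kᶜ = 0 := glue_conull w S
  have hUb : ∀ ω, ω ∈ K →
      (ω ∈ (⋃ s ∈ S, openConn s b : Set (BondConfig (Fin n))) ↔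
        ω ∈ (openConn g b : Set (BondConfig (Fin n)))) := by
    intro ω hωK
    simp only [mem_iUnion]
    constructor
    · rintro ⟨s, hs, hsb⟩
      exact (reachable_of_mem_block hωK hg hs).trans hsb
    · intro hgb
      exact ⟨g, hg, hgb⟩
  have e1 : (prodBernoulli gl).real (⋃ s ∈ S, openConn s b) = (prodBernoulli gl).real (openConn g b) := by
    have := sigmaRec_inter_congr gl (L := univ) hKc (fun ω _ hωK => hUb ω hωK)
    simpa only [univ_inter] using this
  have e2 : (prodBernoulli gl).real (⋃ s ∈ S, openConn s b) = (prodBernoulli w).real (⋃ s ∈ S, openConn s b) :=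
    blockGrowth_glue_real_iUnion w S b
  have h := setGain_glue_le w S x b g hg hmin
  rw [← e2, e1] at h
  exact h

end BlockQ9

end

end Summit.CriticalPhenomena.PercolationContinuityZ3.Theorems
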